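import Summits.QuantumFields.YangMills.Theorems.AlphaInputsT3ACv3ProfileRegularE
import Summits.QuantumFields.YangMills.Theorems.BalabanUVNodesN08AlphaProfileLarge
import HarnessLib

/-!
# `AlphaInputsT3ACv3ProfileLargeE` — STRATEGY B for 2′, (D6L)-CORE FORK, PART F5d′: THE ENLARGED-REGION PROFILE IS `h`-LARGE ((67) at every recorded plaquette) —
# twin of NODE O's `…N08AlphaProfileLarge` §1–§2 over `wgtE`∕`potZE`∕`profE` — lane `pub-balaban3d`, seat alpha-2 (g3)

WHAT (HOME `D6-AUDIT-alpha2-g2.md` §7, F5d′).  For a recorded plaquette `p′ ∈ P_j(h)` (`j < k ≤ K`, `h` admissible) every fine site of the four corner blocks `Δ′(p′)`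
projects into `plaqCover p′ ⊂ Λ_j(h) ⊆ Ω_j(h) ⊆ Ω′_j(h)`, where — by the collar row (N2′) `CollarE` and F4′ (`ThetaE_succ_eq_zero_of_bad`, `ThetaE_eq_one_of_nearE`) — the
enlarged cut-off weights are `ω′_j = 1`, `ω′_{j′} = 0` (`j′ ≠ j`) up to fine distance `2` (§1 `wgtE_near_cover`); so on `Δ′(p′)` the blended potential `potZE` has EXACTLY the
curl of the scale-`j` pattern (`curl_potZE_eq_on_deltaBox`), the four bonds of `∂p′` have tame cones (`coneTame_profE`), the `j`-fold [4]-average of the lift at `∂p′` is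
`exp(curl(linAvgIter potZE j)(z)·X)` (`hol_avgIter_profE`) with `|curl| = amp j·((L^j)²+1)/2` (`abs_curl_linAvgIter_potZE`), and ★ `hLarge_profE`: `|Ū^j(∂p′) − 1| ≥ g_jp(g_j)`
given `C68 ≥ 4π` and `C68·g_jp(g_j) ≤ ¼` — NODE O's proofs VERBATIM with `wgt ↦ wgtE`, `potZ ↦ potZE`, `prof ↦ profE`, `CollarOK ↦ CollarE` (its abelian machinery
`…AbelianLift/Average/Window/Cone`, `…Pattern`, `…Blend` and `…ProfileLarge.mem_deltaBox_of_bounds`∕`SmallOK` reused BY NAME).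
HONEST FRAMING.  Kernel estimates for a CONSTRUCTED test configuration; nothing of [B10]∕[7]∕[4]'s estimates asserted; count-neutral helper toward R3 2′ (`stub_laneRecordsV3`, items
19935∕19936); nothing about d = 4, the continuum, or a mass gap.

References: T. Bałaban, Commun. Math. Phys. 102 (1985) 255–275 [Balaban1985UV3] ((39)–(40) p.266, (67)–(70) p.273); CMP 98 (1985) 17–51 [Balaban1985Averaging] ((42)–(44) pp.23–24).
-/

set_option autoImplicit false

noncomputable section

namespace Summit.QuantumFields.YangMills.Theorems.ProfileEnlarged

open scoped BigOperators Matrix.Norms.L2Operator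
open NormedSpace
open Literature.MathematicalPhysics.QuantumFieldTheory.Balaban1983to89
open Literature.MathematicalPhysics.QuantumFieldTheory.Balaban1983to89.B10 (pFun)
open Literature.MathematicalPhysics.QuantumFieldTheory.Balaban1985CMP102
open Literature.MathematicalPhysics.QuantumFieldTheory.Balaban1985CMP102.Setting
open Summit.QuantumFields.Balaban3D.Carriers
open Summit.QuantumFields.Balaban3D.Proofs.Primitives (AlphaConsts)
open Summit.QuantumFields.Balaban3D.Proofs.LiftBridge (liftCfg)
open Summit.QuantumFields.Balaban3D.Proofs.TorusLift (projSite projSite_add_e zOf projSite_mem_plaqCover)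
open Summit.QuantumFields.Balaban3D.Proofs.Run3Collar (tdist_shift_le)
open Summit.QuantumFields.Balaban3D.Proofs.Run3SmallFactors (codeZ)
open Summit.QuantumFields.Balaban3D.Proofs.AdmissibleRegions (plaqCover_subset_of_admissible)
open Summit.QuantumFields.YangMills.Theorems.BalabanUVNodesN08AlphaClassI (HLarge)
open Summit.QuantumFields.YangMills.Theorems.BalabanUVNodesN08AlphaAbelianLift
open Summit.QuantumFields.YangMills.Theorems.BalabanUVNodesN08AlphaAbelianAverage
open Summit.QuantumFields.YangMills.Theorems.BalabanUVNodesN08AlphaAbelianWindow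
open Summit.QuantumFields.YangMills.Theorems.BalabanUVNodesN08AlphaAbelianCone
open Summit.QuantumFields.YangMills.Theorems.BalabanUVNodesN08AlphaPattern
open Summit.QuantumFields.YangMills.Theorems.BalabanUVNodesN08AlphaHistGeom
open Summit.QuantumFields.YangMills.Theorems.BalabanUVNodesN08AlphaBlend
open Summit.QuantumFields.YangMills.Theorems.BalabanUVNodesN08AlphaProfileBuild (aj aj_pos amp amp_nonneg R0 labZ projSite_labZ)
open Summit.QuantumFields.YangMills.Theorems.BalabanUVNodesN08AlphaProfileLarge (SmallOK mem_deltaBox_of_bounds)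
open B3Taylor310LocalRemainder (tdist_comm tdist_triangle)
open B7Prop1Explicit (e e_apply hol plaqWord expUnit val_expUnit)
open B7Prop2Explicit (avgIter)
open B10Eq70Squaring (deltaBox mem_deltaBox side)

variable {L : ℕ} (S : Scales L) {G : Type} [GaugeGroup G] [MeasurableSpace G] {𝔊 : GroupModel G} (𝔠 : AlphaConsts L 𝔊.N)

/-! ## §1 Near a recorded plaquette the enlarged blend IS the scale-`j` pattern -/

section Local

variable (X : Matrix (Fin 𝔊.N) (Fin 𝔊.N) ℂ) {k : ℕ} (h : Hist S.P k)

/-- **THE ENLARGED WEIGHTS NEAR THE COVER OF A RECORDED PLAQUETTE**: for `p′ ∈ P_j(h)` (`h` admissible, `j < k ≤ K`, collars (N2′)), `x₀ ∈ plaqCover p′` and `tdist x₀ y ≤ 2`: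
`ω′_j(y) = 1` and `ω′_{j′}(y) = 0` for `j′ ≠ j` (`x₀ ∈ Ω_j(h) ⊆ Ω′_j(h)` gives `θ′_{j′}(y) = 1` for `j′ ≤ j`; the collar keeps `θ′_{j+1}` — hence every `θ′_{j′}`, `j′ > j` — off the
cover). [cite: Balaban1985UV3, (39) p.266 + p.273 L14] -/
theorem wgtE_near_cover (hk : k ≤ S.K) (hR : CollarE S 𝔠 k)
    (hadm : Hist.Admissible 𝔠.lane.carrier.M₁ (rcolOf S 𝔠.lane.carrier) k h) {j : ℕ} (hj : j < k) {p : Plaq S.P j} (hp : p ∈ h ⟨j, hj⟩)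
    {x₀ : Site S.P 0} (hx₀ : x₀ ∈ plaqCover p) {y : Site S.P 0} (hy : Site.tdist x₀ y ≤ 2) :
    wgtE S 𝔠 h j y = 1 ∧ ∀ j', j' ≠ j → wgtE S 𝔠 h j' y = 0 := by
  have hkm : k ≤ S.P.m + S.P.K := le_trans hk (Nat.le_add_left _ _)
  have hR1 : 1 ≤ R0 := by norm_num [R0]
  obtain ⟨hΩ, -⟩ := plaqCover_subset_of_admissible 𝔠.lane.carrier.M₁ (rcolOf S 𝔠.lane.carrier) hadm hj hp hx₀
  have hΩE : x₀ ∈ OmegaE 𝔠.lane.carrier.M₁ (rcolOf S 𝔠.lane.carrier) k h j := Omega_subset_OmegaE h _ hΩ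
  -- `θ′_{j'} = 1` for `j' ≤ j`, `θ′_{j'} = 0` for `j' ≥ j + 1`
  have hone : ∀ j', j' ≤ j → ThetaE 𝔠.lane.carrier.M₁ (rcolOf S 𝔠.lane.carrier) R0 h j' y = 1 :=
    fun j' hj' => ThetaE_eq_one_of_nearE S 𝔠 h hkm hR hj.le hΩE hy hj'
  have hzero : ∀ j', j + 1 ≤ j' → ThetaE 𝔠.lane.carrier.M₁ (rcolOf S 𝔠.lane.carrier) R0 h j' y = 0 := by
    intro j' hj'
    have h1 : ThetaE 𝔠.lane.carrier.M₁ (rcolOf S 𝔠.lane.carrier) R0 h (j + 1) y = 0 :=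
      ThetaE_succ_eq_zero_of_bad _ _ R0 h rfl hkm hj hR1 (hR j hj) (Or.inl ⟨p, hp, hx₀⟩) hy
    have hanti := ThetaE_antitone 𝔠.lane.carrier.M₁ (rcolOf S 𝔠.lane.carrier) R0 h rfl hkm hR1 hR hj' y
    have hge := (ThetaE_mem 𝔠.lane.carrier.M₁ (rcolOf S 𝔠.lane.carrier) R0 h j' y).1
    linarith
  refine ⟨?_, fun j' hj' => ?_⟩
  · unfold wgtE; rw [hone j le_rfl, hzero (j + 1) le_rfl]; ring
  · unfold wgtE
    rcases Nat.lt_or_gt_of_ne hj' with hlt | hgt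
    · rw [hone j' hlt.le, hone (j' + 1) (by omega)]; ring
    · rw [hzero j' (by omega), hzero (j' + 1) (by omega)]; ring

/-- **ON `Δ′(p′)` THE ENLARGED BLEND HAS THE CURL OF THE SCALE-`j` PATTERN**: for `x ∈ deltaBox (L^j) (L^j • zOf p′) p′.μ p′.ν` and any directions `μ, ν`,
`curl potZE (x; μ,ν) = curl (patPot (L^j) (amp j)) (x; μ,ν)`. [cite: Balaban1985UV3, (69)–(70) p.273] -/
theorem curl_potZE_eq_on_deltaBox (hk : k ≤ S.K) (hR : CollarE S 𝔠 k)
    (hadm : Hist.Admissible 𝔠.lane.carrier.M₁ (rcolOf S 𝔠.lane.carrier) k h) {j : ℕ} (hj : j < k) {p : Plaq S.P j} (hp : p ∈ h ⟨j, hj⟩)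
    {x : B7Prop1Explicit.Site S.P.d} (hx : x ∈ deltaBox (S.P.L ^ j) ((S.P.L ^ j : ℕ) • zOf p) p.μ p.ν) (μ ν : Fin S.P.d) :
    curl (potZE S 𝔠 X h) x μ ν = curl (patPot (L ^ j) (amp S 𝔠 X j)) x μ ν := by
  have hkm : k ≤ S.P.m + S.P.K := le_trans hk (Nat.le_add_left _ _)
  have hx₀ : projSite x ∈ plaqCover p := projSite_mem_plaqCover (show j ≤ S.P.m + S.P.K by omega) p hx
  have h0 := wgtE_near_cover S 𝔠 h hk hR hadm hj hp hx₀ (y := projSite x) (by rw [tdist_self']; omega)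
  have hμ' := wgtE_near_cover S 𝔠 h hk hR hadm hj hp hx₀ (y := projSite (x + e μ)) (by rw [projSite_add_e]; exact (tdist_shift_le _ μ).trans (by omega))
  have hν' := wgtE_near_cover S 𝔠 h hk hR hadm hj hp hx₀ (y := projSite (x + e ν)) (by rw [projSite_add_e]; exact (tdist_shift_le _ ν).trans (by omega))
  exact curl_blend_eq_of_local (k := k + 1) (projSite (P := S.P)) (wgtE S 𝔠 h) (fun j => patPot (L ^ j) (amp S 𝔠 X j)) x μ ν (j₀ := j) (by omega)
    ⟨h0.1, hμ'.1, hν'.1⟩ (fun j' _ hj' => ⟨h0.2 j' hj', hμ'.2 j' hj', hν'.2 j' hj'⟩)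

/-- `|curl potZE| ≤ amp j` on `Δ′(p′)`. [folklore] -/
theorem abs_curl_potZE_le_on_deltaBox (hX0 : X ≠ 0) (hk : k ≤ S.K) (hR : CollarE S 𝔠 k)
    (hadm : Hist.Admissible 𝔠.lane.carrier.M₁ (rcolOf S 𝔠.lane.carrier) k h) {j : ℕ} (hj : j < k) {p : Plaq S.P j} (hp : p ∈ h ⟨j, hj⟩)
    {x : B7Prop1Explicit.Site S.P.d} (hx : x ∈ deltaBox (S.P.L ^ j) ((S.P.L ^ j : ℕ) • zOf p) p.μ p.ν) (μ ν : Fin S.P.d) :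
    |curl (potZE S 𝔠 X h) x μ ν| ≤ amp S 𝔠 X j := by
  rw [curl_potZE_eq_on_deltaBox S 𝔠 X h hk hR hadm hj hp hx]
  refine (abs_curl_patPot_le (L ^ j) (S.hL.1.pow) _ _ μ ν).trans ?_
  rw [abs_of_nonneg (amp_nonneg S 𝔠 hX0 (by omega))]

end Local

/-! ## §2 The averaged plaquette of the lift at a recorded plaquette, and its size -/

section Large

variable {X : Matrix (Fin 𝔊.N) (Fin 𝔊.N) ℂ} {k : ℕ} (h : Hist S.P k)

/-- **THE FOUR BONDS OF `∂p′` HAVE TAME CONES** for the enlarged profile (F5a's sharp budget: `3·L²·(L^{j−1})²·amp j·‖X‖ = ¾·C68·g_jp(g_j) < log 2` for `j ≥ 1`; trivial at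
`j = 0`). [cite: Balaban1985Averaging, (42)–(43) pp.23–24] -/
theorem coneTame_profE (hX0 : X ≠ 0) (hk : k ≤ S.K) (hR : CollarE S 𝔠 k) (hsm : SmallOK S 𝔠 k)
    (hadm : Hist.Admissible 𝔠.lane.carrier.M₁ (rcolOf S 𝔠.lane.carrier) k h) {j : ℕ} (hj : j < k) {p : Plaq S.P j} (hp : p ∈ h ⟨j, hj⟩)
    (z' : B7Prop1Explicit.Site S.P.d) (κ : Fin S.P.d)
    (hbox : ∀ x, ConeBox L j z' κ x → x ∈ deltaBox (S.P.L ^ j) ((S.P.L ^ j : ℕ) • zOf p) p.μ p.ν) :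
    ConeTame L X (potZE S 𝔠 X h) j z' κ := by
  rcases Nat.eq_zero_or_pos j with rfl | hj1
  · trivial
  have hL1 : 1 ≤ L := le_of_lt S.hL.2
  have hXn : 0 < ‖X‖ := norm_pos_iff.2 hX0
  refine coneTame_of_curl_bound_sharp L hL1 X (potZE S 𝔠 X h) (amp_nonneg S 𝔠 hX0 (by omega)) j z' κ
    (fun x hx μ ν => abs_curl_potZE_le_on_deltaBox S 𝔠 X h hX0 hk hR hadm hj hp (hbox x hx) μ ν) ?_
  -- the budget: `d L² (L^{j-1})² amp j ‖X‖ = 3 · C68 a_j / 4 < log 2`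
  have hd : (S.P.d : ℝ) = 3 := by norm_num [show S.P.d = 3 from rfl]
  have hpow : (L : ℝ) ^ 2 * ((L : ℝ) ^ (j - 1)) ^ 2 = ((L : ℝ) ^ j) ^ 2 := by
    rw [← mul_pow, ← pow_succ', Nat.sub_add_cancel hj1]
  have hL0 : (0 : ℝ) < L := by exact_mod_cast (show 0 < L by omega)
  have hval : (S.P.d : ℝ) * (L : ℝ) ^ 2 * (((L : ℝ) ^ (j - 1)) ^ 2 * amp S 𝔠 X j) * ‖X‖ = 3 * (𝔠.C68 * aj S 𝔠 j) / 4 := by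
    rw [hd, show (3 : ℝ) * (L : ℝ) ^ 2 * (((L : ℝ) ^ (j - 1)) ^ 2 * amp S 𝔠 X j) = 3 * ((L : ℝ) ^ 2 * ((L : ℝ) ^ (j - 1)) ^ 2) * amp S 𝔠 X j by ring,
      hpow, amp]
    field_simp
  rw [hval]
  have hsj := hsm j hj
  have hlog : (0.6 : ℝ) < Real.log 2 := by
    have := Real.log_two_gt_d9; linarith
  linarith

/-- **★ THE AVERAGED PLAQUETTE OF THE LIFT OF THE ENLARGED PROFILE AT A RECORDED PLAQUETTE IS `exp(curl(linAvgIter potZE j)(z)·X)`.** [cite: Balaban1985Averaging, (43)–(44) p.24] -/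
theorem hol_avgIter_profE (hX : X ∈ 𝔊.lie) (hX0 : X ≠ 0) (hk : k ≤ S.K) (hR : CollarE S 𝔠 k) (hsm : SmallOK S 𝔠 k)
    (hadm : Hist.Admissible 𝔠.lane.carrier.M₁ (rcolOf S 𝔠.lane.carrier) k h) {j : ℕ} (hj : j < k) {p : Plaq S.P j} (hp : p ∈ h ⟨j, hj⟩) :
    hol (avgIter L (liftCfg 𝔊 (profE S 𝔠 h hX)) j) (zOf p) (plaqWord p.μ p.ν) =
      expUnit (((curl (linAvgIter L (potZE S 𝔠 X h) j) (zOf p) p.μ p.ν : ℝ) : ℂ) • X) := by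
  have hkm : k ≤ S.P.m + S.P.K := le_trans hk (Nat.le_add_left _ _)
  have hL1 : 1 ≤ L := le_of_lt S.hL.2
  have hPL : S.P.L = L := rfl
  have hμν : p.μ ≠ p.ν := ne_of_lt p.hμν
  rw [liftCfg_profE S 𝔠 h hX hkm]
  -- the four bonds have tame cones (their cone boxes lie in `Δ′(p′)`)
  have hLj : (1 : ℤ) ≤ (L : ℤ) ^ j := by exact_mod_cast Nat.one_le_pow _ _ hL1
  have tame : ∀ (z' : B7Prop1Explicit.Site S.P.d) (κ : Fin S.P.d),
      (∀ i, zOf p i ≤ z' i ∧ z' i + (if i = κ then 1 else 0) ≤ zOf p i + (if i = p.μ ∨ i = p.ν then 1 else 0)) →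
      ConeTame L X (potZE S 𝔠 X h) j z' κ := by
    intro z' κ hz'
    refine coneTame_profE S 𝔠 h hX0 hk hR hsm hadm hj hp z' κ fun x hx => mem_deltaBox_of_bounds S p fun i => ?_
    have h1 := hx i
    have h2 := hz' i
    rw [hPL]
    constructor
    · nlinarith [h1.1, h2.1]
    · have h12 := h1.2; have h22 := h2.2
      split_ifs at h12 h22 ⊢ <;> nlinarith
  have t1 := tame (zOf p) p.μ fun i => by
    by_cases h1 : i = p.μ <;> by_cases h2 : i = p.ν <;> simp [h1, h2, hμν, hμν.symm]
  have t2 := tame (zOf p + e p.μ) p.ν fun i => by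
    by_cases h1 : i = p.μ <;> by_cases h2 : i = p.ν <;> simp [h1, h2, hμν, hμν.symm, Pi.add_apply, e_apply]
  have t3 := tame (zOf p + e p.ν) p.μ fun i => by
    by_cases h1 : i = p.μ <;> by_cases h2 : i = p.ν <;> simp [h1, h2, hμν, hμν.symm, Pi.add_apply, e_apply]
  have t4 := tame (zOf p) p.ν fun i => by
    by_cases h1 : i = p.μ <;> by_cases h2 : i = p.ν <;> simp [h1, h2, hμν, hμν.symm]
  rw [B7Prop1Local.hol_plaqWord_eq, avgIter_abelCfg L hL1 X _ j _ _ t1, avgIter_abelCfg L hL1 X _ j _ _ t2, avgIter_abelCfg L hL1 X _ j _ _ t3,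
    avgIter_abelCfg L hL1 X _ j _ _ t4]
  simp only [abelCfg, inv_expUnit_smul, expUnit_smul_mul_expUnit_smul]
  congr 2

/-- **★ ITS CURL IS THAT OF THE PURE PATTERN**: `|curl (linAvgIter potZE j)(zOf p′)| = amp j·((L^j)² + 1)/2`. [cite: Balaban1985UV3, (69)–(70) p.273] -/
theorem abs_curl_linAvgIter_potZE (X : Matrix (Fin 𝔊.N) (Fin 𝔊.N) ℂ) (hk : k ≤ S.K) (hR : CollarE S 𝔠 k)
    (hadm : Hist.Admissible 𝔠.lane.carrier.M₁ (rcolOf S 𝔠.lane.carrier) k h) {j : ℕ} (hj : j < k) {p : Plaq S.P j} (hp : p ∈ h ⟨j, hj⟩) :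
    |curl (linAvgIter L (potZE S 𝔠 X h) j) (zOf p) p.μ p.ν| = |amp S 𝔠 X j| * ((((L : ℝ) ^ j) ^ 2 + 1) / 2) := by
  have hL1 : 1 ≤ L := le_of_lt S.hL.2
  have hPL : S.P.L = L := rfl
  rw [curl_linAvgIter_congr L hL1 p.μ p.ν j (zOf p) (a' := patPot (L ^ j) (amp S 𝔠 X j)) fun x hx =>
    curl_potZE_eq_on_deltaBox S 𝔠 X h hk hR hadm hj hp (mem_deltaBox_of_bounds S p fun i => ?_) p.μ p.ν]
  · exact abs_curl_linAvgIter_patPot S.hL.1 hL1 (show 1 ≤ S.P.d from by norm_num [show S.P.d = 3 from rfl]) _ j _ p.hμν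
  · have h1 := hx i
    have hμν : p.μ ≠ p.ν := ne_of_lt p.hμν
    have hLj : (1 : ℤ) ≤ (L : ℤ) ^ j := by exact_mod_cast Nat.one_le_pow _ _ hL1
    rw [hPL]
    refine ⟨h1.1, ?_⟩
    have h2 := h1.2
    by_cases hiμ : i = p.μ
    · rw [if_pos hiμ, if_neg (fun h' => hμν (hiμ.symm.trans h'))] at h2
      rw [if_pos (Or.inl hiμ)]; linarith
    · by_cases hiν : i = p.ν
      · rw [if_neg hiμ, if_pos hiν] at h2
        rw [if_pos (Or.inr hiν)]; linarith
      · rw [if_neg hiμ, if_neg hiν] at h2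
        rw [if_neg (not_or.2 ⟨hiμ, hiν⟩)]; linarith

/-- **★ THE ENLARGED-REGION PROFILE IS `h`-LARGE**: at every recorded plaquette `(j, p′)` of the admissible history, `|Ū^j(lift profE)(∂p′) − 1| ≥ g_jp(g_j)` — given `C68 ≥ 4π`,
`C68·g_jp(g_j) ≤ ¼` and the collars (N2′) on the recorded scales. [cite: Balaban1985UV3, (40) p.266 + (67) p.273 L13] -/
theorem hLarge_profE (hX : X ∈ 𝔊.lie) (hX0 : X ≠ 0) (hk : k ≤ S.K) (hR : CollarE S 𝔠 k) (hsm : SmallOK S 𝔠 k) (hC : 4 * Real.pi ≤ 𝔠.C68)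
    (hadm : Hist.Admissible 𝔠.lane.carrier.M₁ (rcolOf S 𝔠.lane.carrier) k h) :
    HLarge S 𝔠.lane.carrier.b₀ 𝔠.lane.carrier.p₀ h (fun j => avgIter L (liftCfg 𝔊 (profE S 𝔠 h hX)) j) := by
  intro e' he'
  obtain ⟨⟨j, hj⟩, p, hp, rfl⟩ := (Hist.mem_disc h e').1 he'
  have hXn : 0 < ‖X‖ := norm_pos_iff.2 hX0
  have hskew := Summit.QuantumFields.Balaban3D.Proofs.GroupModelSkew.conjTranspose_eq_neg_of_mem_lie 𝔊 hX
  -- the recorded plaquette's position and the averaged plaquette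
  have hz : codeZ ((j : ℕ), plaqCode p) = zOf p := rfl
  show S.gk j * pFun 𝔠.lane.carrier.b₀ 𝔠.lane.carrier.p₀ (S.gk j) ≤ _
  rw [hz, show (plaqCode p).2.1 = p.μ from rfl, show (plaqCode p).2.2 = p.ν from rfl, hol_avgIter_profE S 𝔠 h hX hX0 hk hR hsm hadm hj hp, val_expUnit]
  set F : ℝ := curl (linAvgIter L (potZE S 𝔠 X h) j) (zOf p) p.μ p.ν with hF
  have hFabs : |F| = amp S 𝔠 X j * ((((L : ℝ) ^ j) ^ 2 + 1) / 2) := by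
    rw [hF, abs_curl_linAvgIter_potZE S 𝔠 h X hk hR hadm hj hp, abs_of_nonneg (amp_nonneg S 𝔠 hX0 (by omega))]
  -- sizes: `amp j · L^{2j} · ‖X‖ = C68 a_j / 4`
  have hLj : (1 : ℝ) ≤ ((L : ℝ) ^ j) ^ 2 := by
    have : (1 : ℝ) ≤ L := by exact_mod_cast le_of_lt S.hL.2
    exact one_le_pow₀ (one_le_pow₀ this)
  have hL0 : (0 : ℝ) < (L : ℝ) ^ j := by
    have : (0 : ℝ) < L := by exact_mod_cast lt_trans zero_lt_one S.hL.2
    positivity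
  have hampL : amp S 𝔠 X j * ((L : ℝ) ^ j) ^ 2 * ‖X‖ = 𝔠.C68 * aj S 𝔠 j / 4 := by
    unfold amp; field_simp
  have ha0 : 0 ≤ amp S 𝔠 X j := amp_nonneg S 𝔠 hX0 (by omega)
  have haj : 0 < aj S 𝔠 j := aj_pos S 𝔠 (by omega)
  have hsmall := hsm j hj
  -- `|F|‖X‖ ≤ amp L^{2j} ‖X‖ = C68 a_j/4 ≤ π`
  have hupper : |F| * ‖X‖ ≤ Real.pi := by
    rw [hFabs]
    have h1 : amp S 𝔠 X j * ((((L : ℝ) ^ j) ^ 2 + 1) / 2) * ‖X‖ ≤ amp S 𝔠 X j * ((L : ℝ) ^ j) ^ 2 * ‖X‖ := by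
      have : (((L : ℝ) ^ j) ^ 2 + 1) / 2 ≤ ((L : ℝ) ^ j) ^ 2 := by linarith
      gcongr
    have h2 : 𝔠.C68 * aj S 𝔠 j / 4 ≤ Real.pi := by linarith [Real.pi_gt_three]
    linarith [hampL]
  -- lower bound
  have hlow := abs_mul_norm_le_of_exp hskew hupper
  have hF2 : amp S 𝔠 X j * ((L : ℝ) ^ j) ^ 2 * ‖X‖ / 2 ≤ |F| * ‖X‖ := by
    rw [hFabs]
    have : ((L : ℝ) ^ j) ^ 2 / 2 ≤ (((L : ℝ) ^ j) ^ 2 + 1) / 2 := by linarith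
    have hx := mul_le_mul_of_nonneg_left this ha0
    nlinarith [norm_nonneg X]
  -- `a_j ≤ C68 a_j/(4π) ≤ (2/π)|F|‖X‖ ≤ ‖exp − 1‖`
  have hpi : 0 < Real.pi := Real.pi_pos
  have key : S.gk j * pFun 𝔠.lane.carrier.b₀ 𝔠.lane.carrier.p₀ (S.gk j) ≤ 2 / Real.pi * (|F| * ‖X‖) := by
    change aj S 𝔠 j ≤ _
    have h1 : aj S 𝔠 j ≤ 𝔠.C68 * aj S 𝔠 j / (4 * Real.pi) := by
      rw [le_div_iff₀ (by positivity)]; nlinarith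
    have h2 : 𝔠.C68 * aj S 𝔠 j / (4 * Real.pi) = 2 / Real.pi * (𝔠.C68 * aj S 𝔠 j / 4 / 2) := by field_simp
    rw [h2] at h1
    refine h1.trans (mul_le_mul_of_nonneg_left ?_ (by positivity))
    linarith [hampL]
  refine key.trans ?_
  rw [div_mul_eq_mul_div, div_le_iff₀ hpi]
  linarith

end Large

end Summit.QuantumFields.YangMills.Theorems.ProfileEnlarged

end
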